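import Summits.QuantumFields.YangMills.Theorems.BalabanUVNodesN27AtRecord13HomeOn
import Summits.QuantumFields.YangMills.Theorems.BalabanUVNodesN22EdgeAtW1Reading13
import Summits.QuantumFields.YangMills.Theorems.BalabanUVNodesN16AtRRec13
import Summits.QuantumFields.YangMills.Theorems.BalabanUVNodesN17AtSpineCarriers

/-!
# BalabanUVNodes ∕ N27 = binder B5 AT THE RECORD, XL — N27 AT THE STAGE-13 RATE READING OF RECORD, EDITION 1
# `YMDAG.UVSplit.readingOfRecord₁₃ w1 ℓ₃ ne2 ne1` (dag-n22-e 6″, `…RateReadingOfRecord13`: node U3's objects := node00-def-W1's `(w1 F θ).u3Objects θ.γ` over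
# `w1 : (F : T4Family) → (θ : Stage13Params F N) → W1.ReadingData F (MatA N) θ.τ9.M`, N16's layer := node00-def-RR-1's constant layer of record `ne3ConstLayerOfRecord₁₁ F N (ℓ₃ F)`,
# N15's `ne2` and NODE O's dressed tower `ne1` residual, all ₁₃-typed): the two Stage-13 knits of record (XXXVIII `spine_rec13C_of_homes₁₃` at the canonical homes, XXXIX
# `spine_rec13COn_of_homes₁₃On` at the regime-restricted homes) INSTANTIATED at the children's NAMED rate reading, the N17 slot ELIMINATED by name (dag-n17-a
# `YMDAG.N17.s_N17_of_D4_N18`: NE4 ⟸ (D4) read-out ∧ NE5 at ANY rate record), N16's slot from its content form (dag-n16-e module 19 `…N16AtRRec13` §5∕§6), and every remaining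
# rate slot UNFOLDED through dag-n22-e's ₁₃ dictionary into its sentence about NAMED objects — the kernel-checked FIELD-BY-FIELD TABLE of K3‴'s rate side at the ₁₃ reading of
# record; the ₁₃ twin of module XXIX
# (cell `pub-ymgap`, HUMAN RULING D-0062 Track A, R134 seat `pub-ymgap-dag-n27-c` (s2) gen 6; `--supports stmt-QuantumFields-19912 --as helper` — K3‴ `SpineGivenEndpointR13`;
# COUNT-NEUTRAL; `N`-generic, regime-generic, NO Theses import, restate-immune; the route-facing `N = 2` line is module XXXVII's `spineGivenEndpointR13_at_readingOfRecord₁₃On`, append-only)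

FIELD-BY-FIELD TABLE (rate side at `readingOfRecord₁₃ w1 ℓ₃ ne2 ne1`; canonical home reads at the datum key's parameter `h.params`, regime home at the tuple `θ` itself):
* N14 · NE1′ — `N14At (ne1 F θ g₀ os)` on the RESIDUAL dressed tower (NODE O's object; no producer at the reading).
* N15 · NE2 — `N15At (ne2OfRecord₁₁ (ne2 F θ g₀ os k))` on the RESIDUAL paired layers (dag-n15-a part 33 `…N15AtRateRecord13` at any ₁₃ reading).
* N16 · NE3 — `N16At (ne3OfRecord₁₁ F (ne3ConstLayerOfRecord₁₁ F N (ℓ₃ F)))`, ONE sentence per (guarded) family; from `InEndRegime ∧ LeafSlot` there (dag-n16-e module 19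
  `s_N16_rRec₁₃_of_constLayer_leafSlot` ∕ `s_N16_rRec₁₃On_ofRecord_of_leafSlot`, pin `rfl` at the reading of record).
* N17 · NE4 — ELIMINATED: `YMDAG.N17.s_N17_of_D4_N18` at the home, so the slot is (D4) below + N18.
* N18 · NE5 — `N18At (u3OfRecord₁₃ θ ((w1 F θ).u3Objects θ.γ) k)` (`g₀`, `os` IDLE); producers dag-n18-d∕e (₁₂ faces at the admissible ∕ plaquette-small tables; ₁₃ re-key pending).
* N22 · NE9 — `N22At (u3OfRecord₁₃ θ ((w1 F θ).u3Objects θ.γ) k)` (`g₀`, `os` IDLE); producers dag-n22-e 9″a∕9″c at ₁₃ (`s_N22_rRec₁₃_of_s_N18{,_strip,_analytic}`,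
  `s_N22_rRec₁₃_w1_of_oscAnalytic ∕ _of_ne9_fading`), dag-n22-c (₁₂ strip ∕ level-T faces; ₁₃ re-key pending).
* (D4) — `ReadOutAt D (u3OfRecord₁₃ θ ((w1 F θ).u3Objects θ.γ) k)`: the β-read-out binders (displayed; (D4) chain dag-n26 ∕ b2b at Record 13).
* `S_R00x` — not asked (XXXIX) ∕ by name (XXXVIII, `s_R00x_rRec₁₃`).
Spine side (`cr : SpineReading₁₃ N`; N20 `RelWeightBound`, N21 `ShellWeightBound`, the keyed extraction clause, the same-tuple N19′ `NE7.Core` edge) stays PARAMETRIC: no spine reading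
of record exists; dag-n20-d ∕ n21-d's ₁₃ closers plug in at `SRec₁₃(On) cr`.

WHAT THIS MODULE PROVES ([bookkeeping], every theorem ONE application of a named theorem with the dictionary's `Iff`s).
* §1 CANONICAL HOME `RRec₁₃ (readingOfRecord₁₃ w1 ℓ₃ ne2 ne1)` ⇒ `Spine ₁₃C`: `spine_rec13C_at_readingOfRecord₁₃` (stub form, five rate stubs + (D4)) ·
  `spine_rec13C_at_readingOfRecord₁₃_unfolded` (dictionary form, dag-n22-e `s_N1x_readingOfRecord₁₃_iff`) · `spine_rec13C_at_readingOfRecord₁₃_of_leafSlot` (N16 from `InEndRegime ∧ LeafSlot`).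
* §2 REGIME HOME `RRec₁₃On (readingOfRecord₁₃ w1 ℓ₃ ne2 ne1) Rg` (any regime `Rg`) ⇒ `Spine` at RR-2's regime record class `IsRecordOfRecord₁₃COn F N Rg`:
  `spine_rec13COn_at_readingOfRecord₁₃` (stub form) · `spine_rec13COn_at_readingOfRecord₁₃_unfolded` (θ-form sentences read AT θ, dag-n22-e `s_N1x_rRec₁₃On_iff` + the reading's
  `rfl` component faces) · `spine_rec13COn_at_readingOfRecord₁₃_of_leafSlot` (at `Rg := Node00.unityNondeg₁₃ N` the conclusion is `Spine ₁₃CN` = THE ITEM at `N = 2`, XXXVII §4).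

HONEST FRAMING.  COUNT-NEUTRAL kernel bookkeeping BY NAME at a COMPOSITE node; every node estimate (NE1′, NE2, NE3's `InEndRegime`∕`LeafSlot`, NE5, NE9, (D4), NE7b, NE7c, the
extraction clause, NE7's core edge) is a DISPLAYED hypothesis; the reading's W1 towers, `ne2`, `ne1` are residual DATA inside named containers (INHABITATION IS NOT CONTENT); no
inhabitant of any record class is claimed (K0‴ `Record13Inhabited`, stmt-QuantumFields-19909, open); nothing of Bałaban's asserted or instantiated; NE1′–NE9 ∕ NE7 ∕ NE7b ∕ NE7c
are NOT PRINTED for d = 4 and NOT PROVED; N27 NOT discharged, K3‴ NOT claimed; counts UNMOVED (typed 28∕28 · discharged 5∕27, A 5∕28); one finite four-torus programme at fixed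
`ε` — NOT ℝ⁴, NOT infinite volume, NOT OS, NOT a mass gap, NOT Clay.  No decl below carries a cite tag.
-/

namespace Summit.QuantumFields.YangMills.Theorems.BalabanUVNodesN27SpineRecord

open Literature.MathematicalPhysics.QuantumFieldTheory.Balaban1983to89
open Literature.MathematicalPhysics.QuantumFieldTheory.Balaban1983to89.T4Continuum
open T4ContinuumYM4Torus (ForSmallCouplings)
open Summit.QuantumFields.BalabanUV.T4Continuum.Spine
open YMDAG.UVSplit
open Node00 (Stage13Params datumOfRecord₁₃ IsRecordOfRecord₁₃C IsDatumOfRecord₁₃C NE3Letters₁₁ NE2Objects₁₁ ne3ConstLayerOfRecord₁₁)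
open Summit.QuantumFields.YangMills.BalabanUVNodes.N16Regime (InEndRegime)
open Summit.QuantumFields.YangMills.BalabanUVNodes.N16LeafSlot (LeafSlot)
open Summit.QuantumFields.YangMills.BalabanUVNodes.N16AtRRec13 (s_N16_rRec₁₃_of_constLayer_leafSlot s_N16_rRec₁₃On_ofRecord_of_leafSlot)

variable {N : ℕ} [NeZero N] (cr : SpineReading₁₃ N)
  (w1 : (F : T4Family) → (θ : Stage13Params F N) → Node00.W1.ReadingData F (Node00.MatA N) θ.τ9.M) (ℓ₃ : T4Family → NE3Letters₁₁)
  (ne2 : (F : T4Family) → Stage13Params F N → (ℕ → ℝ) → List (ULoop F) → ℕ → NE2Objects₁₁)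
  (ne1 : (F : T4Family) → Stage13Params F N → (ℕ → ℝ) → List (ULoop F) → NE1pCarriers)

/-! ## §1 The canonical home at the reading of record -/

section Canonical

/-- **N27 = B5 AT THE STAGE-13 RECORD FROM THE STUBS AT THE CANONICAL HOME OF THE READING OF RECORD, N17 ELIMINATED** (XXXVIII `spine_rec13C_of_homes₁₃` at
`𝔯 := readingOfRecord₁₃ w1 ℓ₃ ne2 ne1`, `h17 := YMDAG.N17.s_N17_of_D4_N18 _ hD4 h18`): the five rate stubs N14 · N15 · N16 · N18 · N22 and the (D4) read-out stub at
`RRec₁₃ (readingOfRecord₁₃ …)`, the three K5 stubs at `SRec₁₃ cr` and the home-keyed N19′ edge ⇒ `Spine ₁₃C`.  Every hypothesis 0∕1 today. [bookkeeping] -/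
theorem spine_rec13C_at_readingOfRecord₁₃
    (h14 : S_N14 (RRec₁₃ (readingOfRecord₁₃ w1 ℓ₃ ne2 ne1))) (h15 : S_N15 (RRec₁₃ (readingOfRecord₁₃ w1 ℓ₃ ne2 ne1)))
    (h16 : S_N16 (RRec₁₃ (readingOfRecord₁₃ w1 ℓ₃ ne2 ne1))) (h18 : S_N18 (RRec₁₃ (readingOfRecord₁₃ w1 ℓ₃ ne2 ne1)))
    (h22 : S_N22 (RRec₁₃ (readingOfRecord₁₃ w1 ℓ₃ ne2 ne1))) (hD4 : S_D4 (RRec₁₃ (readingOfRecord₁₃ w1 ℓ₃ ne2 ne1)))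
    (hx' : S_N27x (fun F D w => IsRecordOfRecord₁₃C F N D w) (SRec₁₃ cr)) (h20 : S_N20 (SRec₁₃ cr)) (h21 : S_N21 (SRec₁₃ cr))
    (h19 : ∀ (F : T4Family) (θ : Stage13Params F N) (hP : θ.Provisos₁₃ F N), θ.Admissible F N → ∀ (g₀ : ℕ → ℝ) (os : List (ULoop F))
      (h : IsDatumOfRecord₁₃C F N (datumOfRecord₁₃ F N θ hP)) (k : ℕ),
      RatesAt (datumOfRecord₁₃ F N θ hP) (rateCarriersOfRecord₁₃ (readingOfRecord₁₃ w1 ℓ₃ ne2 ne1) F h.params h.provisos g₀ os k) → letI := (cr F θ hP g₀ os).dec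
        ∃ δ : ℕ → ℝ, NE7.Core (cr F θ hP g₀ os).l₀ (cr F θ hP g₀ os).vol (cr F θ hP g₀ os).T (cr F θ hP g₀ os).Bad
          (fun K t τ => (cr F θ hP g₀ os).A K t τ - (cr F θ hP g₀ os).shA K t τ) (fun K t τ => (cr F θ hP g₀ os).B K t τ - (cr F θ hP g₀ os).shB K t τ) δ ∧
          Summable δ) :
    Spine (N := N) fun F D w => IsRecordOfRecord₁₃C F N D w :=
  spine_rec13C_of_homes₁₃ cr _ h14 h15 h16 (YMDAG.N17.s_N17_of_D4_N18 _ hD4 h18) h18 h22 hx' h20 h21 h19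

/-- **THE SAME WITH EVERY RATE SLOT UNFOLDED INTO ITS SENTENCE ABOUT NAMED OBJECTS** (dag-n22-e's dictionary `s_N14∕s_N15∕s_N16∕s_N18∕s_N22∕s_D4_readingOfRecord₁₃_iff`, read at the
datum key's canonical parameter `h.params`): NE1′ on the residual dressed tower `ne1`, NE2 on the residual layers `ne2`, NE3 at node00-def-RR-1's constant layer of record ONCE PER
FAMILY, NE5 ∕ NE9 ∕ (D4) on node00-def-W1's objects `(w1 F h.params).u3Objects h.params.γ` at every run length — `g₀`, `os` IDLE in the last four. [bookkeeping] -/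
theorem spine_rec13C_at_readingOfRecord₁₃_unfolded
    (h14 : ∀ (F : T4Family) (D : Datum F N) (h : IsDatumOfRecord₁₃C F N D) (g₀ : ℕ → ℝ) (os : List (ULoop F)), N14At (ne1 F h.params g₀ os))
    (h15 : ∀ (F : T4Family) (D : Datum F N) (h : IsDatumOfRecord₁₃C F N D) (g₀ : ℕ → ℝ) (os : List (ULoop F)) (k : ℕ),
      N15At (ne2OfRecord₁₁ (ne2 F h.params g₀ os k)))
    (h16 : ∀ (F : T4Family), (∃ D : Datum F N, IsDatumOfRecord₁₃C F N D) → N16At (ne3OfRecord₁₁ F (ne3ConstLayerOfRecord₁₁ F N (ℓ₃ F))))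
    (h18 : ∀ (F : T4Family) (D : Datum F N) (h : IsDatumOfRecord₁₃C F N D) (k : ℕ), N18At (u3OfRecord₁₃ h.params ((w1 F h.params).u3Objects h.params.γ) k))
    (h22 : ∀ (F : T4Family) (D : Datum F N) (h : IsDatumOfRecord₁₃C F N D) (k : ℕ), N22At (u3OfRecord₁₃ h.params ((w1 F h.params).u3Objects h.params.γ) k))
    (hD4 : ∀ (F : T4Family) (D : Datum F N) (h : IsDatumOfRecord₁₃C F N D) (k : ℕ), ReadOutAt D (u3OfRecord₁₃ h.params ((w1 F h.params).u3Objects h.params.γ) k))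
    (hx' : S_N27x (fun F D w => IsRecordOfRecord₁₃C F N D w) (SRec₁₃ cr)) (h20 : S_N20 (SRec₁₃ cr)) (h21 : S_N21 (SRec₁₃ cr))
    (h19 : ∀ (F : T4Family) (θ : Stage13Params F N) (hP : θ.Provisos₁₃ F N), θ.Admissible F N → ∀ (g₀ : ℕ → ℝ) (os : List (ULoop F))
      (h : IsDatumOfRecord₁₃C F N (datumOfRecord₁₃ F N θ hP)) (k : ℕ),
      RatesAt (datumOfRecord₁₃ F N θ hP) (rateCarriersOfRecord₁₃ (readingOfRecord₁₃ w1 ℓ₃ ne2 ne1) F h.params h.provisos g₀ os k) → letI := (cr F θ hP g₀ os).dec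
        ∃ δ : ℕ → ℝ, NE7.Core (cr F θ hP g₀ os).l₀ (cr F θ hP g₀ os).vol (cr F θ hP g₀ os).T (cr F θ hP g₀ os).Bad
          (fun K t τ => (cr F θ hP g₀ os).A K t τ - (cr F θ hP g₀ os).shA K t τ) (fun K t τ => (cr F θ hP g₀ os).B K t τ - (cr F θ hP g₀ os).shB K t τ) δ ∧
          Summable δ) :
    Spine (N := N) fun F D w => IsRecordOfRecord₁₃C F N D w :=
  spine_rec13C_at_readingOfRecord₁₃ cr w1 ℓ₃ ne2 ne1 ((s_N14_readingOfRecord₁₃_iff w1 ℓ₃ ne2 ne1).mpr h14)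
    ((s_N15_readingOfRecord₁₃_iff w1 ℓ₃ ne2 ne1).mpr h15) ((s_N16_readingOfRecord₁₃_iff w1 ℓ₃ ne2 ne1).mpr h16)
    ((s_N18_readingOfRecord₁₃_iff w1 ℓ₃ ne2 ne1).mpr h18) ((s_N22_readingOfRecord₁₃_iff w1 ℓ₃ ne2 ne1).mpr h22)
    ((s_D4_readingOfRecord₁₃_iff w1 ℓ₃ ne2 ne1).mpr hD4) hx' h20 h21 h19

/-- **… WITH N16's SENTENCE FROM ITS CONTENT FORM** `InEndRegime ∧ LeafSlot` at node00-def-RR-1's layer of every family carrying a Stage-13 datum of record (dag-n16-e module 19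
`s_N16_rRec₁₃_of_constLayer_leafSlot` at the constant layer of record, pin `rfl` at the reading of record). [bookkeeping] -/
theorem spine_rec13C_at_readingOfRecord₁₃_of_leafSlot
    (h14 : ∀ (F : T4Family) (D : Datum F N) (h : IsDatumOfRecord₁₃C F N D) (g₀ : ℕ → ℝ) (os : List (ULoop F)), N14At (ne1 F h.params g₀ os))
    (h15 : ∀ (F : T4Family) (D : Datum F N) (h : IsDatumOfRecord₁₃C F N D) (g₀ : ℕ → ℝ) (os : List (ULoop F)) (k : ℕ),
      N15At (ne2OfRecord₁₁ (ne2 F h.params g₀ os k)))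
    (h16 : ∀ (F : T4Family), (∃ D : Datum F N, IsDatumOfRecord₁₃C F N D) →
      InEndRegime (ne3OfRecord₁₁ F (ne3ConstLayerOfRecord₁₁ F N (ℓ₃ F))) ∧ LeafSlot (ne3OfRecord₁₁ F (ne3ConstLayerOfRecord₁₁ F N (ℓ₃ F))))
    (h18 : ∀ (F : T4Family) (D : Datum F N) (h : IsDatumOfRecord₁₃C F N D) (k : ℕ), N18At (u3OfRecord₁₃ h.params ((w1 F h.params).u3Objects h.params.γ) k))
    (h22 : ∀ (F : T4Family) (D : Datum F N) (h : IsDatumOfRecord₁₃C F N D) (k : ℕ), N22At (u3OfRecord₁₃ h.params ((w1 F h.params).u3Objects h.params.γ) k))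
    (hD4 : ∀ (F : T4Family) (D : Datum F N) (h : IsDatumOfRecord₁₃C F N D) (k : ℕ), ReadOutAt D (u3OfRecord₁₃ h.params ((w1 F h.params).u3Objects h.params.γ) k))
    (hx' : S_N27x (fun F D w => IsRecordOfRecord₁₃C F N D w) (SRec₁₃ cr)) (h20 : S_N20 (SRec₁₃ cr)) (h21 : S_N21 (SRec₁₃ cr))
    (h19 : ∀ (F : T4Family) (θ : Stage13Params F N) (hP : θ.Provisos₁₃ F N), θ.Admissible F N → ∀ (g₀ : ℕ → ℝ) (os : List (ULoop F))
      (h : IsDatumOfRecord₁₃C F N (datumOfRecord₁₃ F N θ hP)) (k : ℕ),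
      RatesAt (datumOfRecord₁₃ F N θ hP) (rateCarriersOfRecord₁₃ (readingOfRecord₁₃ w1 ℓ₃ ne2 ne1) F h.params h.provisos g₀ os k) → letI := (cr F θ hP g₀ os).dec
        ∃ δ : ℕ → ℝ, NE7.Core (cr F θ hP g₀ os).l₀ (cr F θ hP g₀ os).vol (cr F θ hP g₀ os).T (cr F θ hP g₀ os).Bad
          (fun K t τ => (cr F θ hP g₀ os).A K t τ - (cr F θ hP g₀ os).shA K t τ) (fun K t τ => (cr F θ hP g₀ os).B K t τ - (cr F θ hP g₀ os).shB K t τ) δ ∧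
          Summable δ) :
    Spine (N := N) fun F D w => IsRecordOfRecord₁₃C F N D w :=
  spine_rec13C_at_readingOfRecord₁₃ cr w1 ℓ₃ ne2 ne1 ((s_N14_readingOfRecord₁₃_iff w1 ℓ₃ ne2 ne1).mpr h14)
    ((s_N15_readingOfRecord₁₃_iff w1 ℓ₃ ne2 ne1).mpr h15)
    (s_N16_rRec₁₃_of_constLayer_leafSlot (readingOfRecord₁₃ w1 ℓ₃ ne2 ne1) (fun F => ne3ConstLayerOfRecord₁₁ F N (ℓ₃ F)) (fun _ _ _ _ _ _ => rfl) h16)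
    ((s_N18_readingOfRecord₁₃_iff w1 ℓ₃ ne2 ne1).mpr h18) ((s_N22_readingOfRecord₁₃_iff w1 ℓ₃ ne2 ne1).mpr h22)
    ((s_D4_readingOfRecord₁₃_iff w1 ℓ₃ ne2 ne1).mpr hD4) hx' h20 h21 h19

end Canonical

/-! ## §2 The regime-restricted home at the reading of record, any regime `Rg` -/

section Regime

variable (Rg : (F : T4Family) → Stage13Params F N → Prop)

/-- **N27 = B5 AT THE REGIME RECORD CLASS FROM THE STUBS AT THE REGIME HOME OF THE READING OF RECORD, N17 ELIMINATED** (XXXIX `spine_rec13COn_of_homes₁₃On` at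
`𝔯 := readingOfRecord₁₃ w1 ℓ₃ ne2 ne1`, `h17 := YMDAG.N17.s_N17_of_D4_N18 _ hD4 h18`): the five rate stubs and (D4) at `RRec₁₃On (readingOfRecord₁₃ …) Rg`, N20 ∕ N21 at `SRec₁₃On cr Rg`,
the guarded keyed extraction clause and the same-tuple all-run-lengths N19′ edge ⇒ `Spine` at `IsRecordOfRecord₁₃COn F N Rg`.  Every hypothesis 0∕1 today. [bookkeeping] -/
theorem spine_rec13COn_at_readingOfRecord₁₃
    (h14 : S_N14 (RRec₁₃On (readingOfRecord₁₃ w1 ℓ₃ ne2 ne1) Rg)) (h15 : S_N15 (RRec₁₃On (readingOfRecord₁₃ w1 ℓ₃ ne2 ne1) Rg))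
    (h16 : S_N16 (RRec₁₃On (readingOfRecord₁₃ w1 ℓ₃ ne2 ne1) Rg)) (h18 : S_N18 (RRec₁₃On (readingOfRecord₁₃ w1 ℓ₃ ne2 ne1) Rg))
    (h22 : S_N22 (RRec₁₃On (readingOfRecord₁₃ w1 ℓ₃ ne2 ne1) Rg)) (hD4 : S_D4 (RRec₁₃On (readingOfRecord₁₃ w1 ℓ₃ ne2 ne1) Rg))
    (h20 : S_N20 (SRec₁₃On cr Rg)) (h21 : S_N21 (SRec₁₃On cr Rg))
    (hx : ∀ (F : T4Family) (θ : Stage13Params F N) (hP : θ.Provisos₁₃ F N), Rg F θ → θ.Admissible F N →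
      B16.EndStatementBPrinted (datumOfRecord₁₃ F N θ hP).C → DagBinding.EndpointExistence (datumOfRecord₁₃ F N θ hP).C.toB12 →
        ForSmallCouplings (datumOfRecord₁₃ F N θ hP) fun g₀ => ∀ os : List (ULoop F),
          0 < (cr F θ hP g₀ os).l₀ ∧ 0 < (cr F θ hP g₀ os).vol ∧
          (∀ (K : ℕ) (t : ℝ), |t| ≤ (cr F θ hP g₀ os).l₀ →
            T4GenFunBounds.schemeZ ((datumOfRecord₁₃ F N θ hP).scheme g₀) os ((cr F θ hP g₀ os).K₀ + K) t =
              ∑ τ ∈ (cr F θ hP g₀ os).T K, (cr F θ hP g₀ os).A K t τ) ∧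
          (∀ (K : ℕ) (t : ℝ), |t| ≤ (cr F θ hP g₀ os).l₀ →
            T4GenFunBounds.schemeZ ((datumOfRecord₁₃ F N θ hP).scheme g₀) os ((cr F θ hP g₀ os).K₀ + K + 1) t =
              ∑ τ ∈ (cr F θ hP g₀ os).T K, (cr F θ hP g₀ os).B K t τ))
    (h19 : ∀ (F : T4Family) (θ : Stage13Params F N) (hP : θ.Provisos₁₃ F N), Rg F θ → θ.Admissible F N → ∀ (g₀ : ℕ → ℝ) (os : List (ULoop F)),
      (∀ k : ℕ, RatesAt (datumOfRecord₁₃ F N θ hP) (rateCarriersOfRecord₁₃ (readingOfRecord₁₃ w1 ℓ₃ ne2 ne1) F θ hP g₀ os k)) → letI := (cr F θ hP g₀ os).dec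
        ∃ δ : ℕ → ℝ, NE7.Core (cr F θ hP g₀ os).l₀ (cr F θ hP g₀ os).vol (cr F θ hP g₀ os).T (cr F θ hP g₀ os).Bad
          (fun K t τ => (cr F θ hP g₀ os).A K t τ - (cr F θ hP g₀ os).shA K t τ) (fun K t τ => (cr F θ hP g₀ os).B K t τ - (cr F θ hP g₀ os).shB K t τ) δ ∧
          Summable δ) :
    Spine (N := N) fun F D w => Node00.IsRecordOfRecord₁₃COn F N Rg D w :=
  spine_rec13COn_of_homes₁₃On cr _ Rg h14 h15 h16 (YMDAG.N17.s_N17_of_D4_N18 _ hD4 h18) h18 h22 h20 h21 hx h19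

/-- **THE SAME WITH EVERY RATE SLOT UNFOLDED INTO ITS GUARDED θ-FORM SENTENCE READ AT θ** (dag-n22-e `s_N1x_rRec₁₃On_iff` at the reading of record, components by `rfl`; N16 in
the once-per-guarded-family form, dag-n22-e `s_N16_readingOfRecord₁₃On_iff`): for every family, every Stage-13 tuple with provisos IN THE REGIME, admissible — NE1′ on
`ne1 F θ g₀ os`, NE2 on `ne2 F θ g₀ os k`, NE5 ∕ NE9 ∕ (D4) on `(w1 F θ).u3Objects θ.γ` at every run length (`g₀`, `os` IDLE); NE3 once per guarded family. [bookkeeping] -/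
theorem spine_rec13COn_at_readingOfRecord₁₃_unfolded
    (h14 : ∀ (F : T4Family) (θ : Stage13Params F N), θ.Provisos₁₃ F N → Rg F θ → θ.Admissible F N → ∀ (g₀ : ℕ → ℝ) (os : List (ULoop F)),
      N14At (ne1 F θ g₀ os))
    (h15 : ∀ (F : T4Family) (θ : Stage13Params F N), θ.Provisos₁₃ F N → Rg F θ → θ.Admissible F N → ∀ (g₀ : ℕ → ℝ) (os : List (ULoop F)) (k : ℕ),
      N15At (ne2OfRecord₁₁ (ne2 F θ g₀ os k)))
    (h16 : ∀ (F : T4Family), (∃ θ : Stage13Params F N, θ.Provisos₁₃ F N ∧ Rg F θ ∧ θ.Admissible F N) →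
      N16At (ne3OfRecord₁₁ F (ne3ConstLayerOfRecord₁₁ F N (ℓ₃ F))))
    (h18 : ∀ (F : T4Family) (θ : Stage13Params F N), θ.Provisos₁₃ F N → Rg F θ → θ.Admissible F N → ∀ k : ℕ,
      N18At (u3OfRecord₁₃ θ ((w1 F θ).u3Objects θ.γ) k))
    (h22 : ∀ (F : T4Family) (θ : Stage13Params F N), θ.Provisos₁₃ F N → Rg F θ → θ.Admissible F N → ∀ k : ℕ,
      N22At (u3OfRecord₁₃ θ ((w1 F θ).u3Objects θ.γ) k))
    (hD4 : ∀ (F : T4Family) (θ : Stage13Params F N) (hP : θ.Provisos₁₃ F N), Rg F θ → θ.Admissible F N → ∀ k : ℕ,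
      ReadOutAt (datumOfRecord₁₃ F N θ hP) (u3OfRecord₁₃ θ ((w1 F θ).u3Objects θ.γ) k))
    (h20 : S_N20 (SRec₁₃On cr Rg)) (h21 : S_N21 (SRec₁₃On cr Rg))
    (hx : ∀ (F : T4Family) (θ : Stage13Params F N) (hP : θ.Provisos₁₃ F N), Rg F θ → θ.Admissible F N →
      B16.EndStatementBPrinted (datumOfRecord₁₃ F N θ hP).C → DagBinding.EndpointExistence (datumOfRecord₁₃ F N θ hP).C.toB12 →
        ForSmallCouplings (datumOfRecord₁₃ F N θ hP) fun g₀ => ∀ os : List (ULoop F),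
          0 < (cr F θ hP g₀ os).l₀ ∧ 0 < (cr F θ hP g₀ os).vol ∧
          (∀ (K : ℕ) (t : ℝ), |t| ≤ (cr F θ hP g₀ os).l₀ →
            T4GenFunBounds.schemeZ ((datumOfRecord₁₃ F N θ hP).scheme g₀) os ((cr F θ hP g₀ os).K₀ + K) t =
              ∑ τ ∈ (cr F θ hP g₀ os).T K, (cr F θ hP g₀ os).A K t τ) ∧
          (∀ (K : ℕ) (t : ℝ), |t| ≤ (cr F θ hP g₀ os).l₀ →
            T4GenFunBounds.schemeZ ((datumOfRecord₁₃ F N θ hP).scheme g₀) os ((cr F θ hP g₀ os).K₀ + K + 1) t =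
              ∑ τ ∈ (cr F θ hP g₀ os).T K, (cr F θ hP g₀ os).B K t τ))
    (h19 : ∀ (F : T4Family) (θ : Stage13Params F N) (hP : θ.Provisos₁₃ F N), Rg F θ → θ.Admissible F N → ∀ (g₀ : ℕ → ℝ) (os : List (ULoop F)),
      (∀ k : ℕ, RatesAt (datumOfRecord₁₃ F N θ hP) (rateCarriersOfRecord₁₃ (readingOfRecord₁₃ w1 ℓ₃ ne2 ne1) F θ hP g₀ os k)) → letI := (cr F θ hP g₀ os).dec
        ∃ δ : ℕ → ℝ, NE7.Core (cr F θ hP g₀ os).l₀ (cr F θ hP g₀ os).vol (cr F θ hP g₀ os).T (cr F θ hP g₀ os).Bad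
          (fun K t τ => (cr F θ hP g₀ os).A K t τ - (cr F θ hP g₀ os).shA K t τ) (fun K t τ => (cr F θ hP g₀ os).B K t τ - (cr F θ hP g₀ os).shB K t τ) δ ∧
          Summable δ) :
    Spine (N := N) fun F D w => Node00.IsRecordOfRecord₁₃COn F N Rg D w :=
  spine_rec13COn_at_readingOfRecord₁₃ cr w1 ℓ₃ ne2 ne1 Rg
    ((s_N14_rRec₁₃On_iff _ Rg).mpr fun F θ hP hRg hθ g₀ os => h14 F θ hP hRg hθ g₀ os)
    ((s_N15_rRec₁₃On_iff _ Rg).mpr fun F θ hP hRg hθ g₀ os k => h15 F θ hP hRg hθ g₀ os k)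
    ((s_N16_readingOfRecord₁₃On_iff w1 ℓ₃ ne2 ne1 Rg).mpr h16)
    ((s_N18_rRec₁₃On_iff _ Rg).mpr fun F θ hP hRg hθ _ _ k => h18 F θ hP hRg hθ k)
    ((s_N22_rRec₁₃On_iff _ Rg).mpr fun F θ hP hRg hθ _ _ k => h22 F θ hP hRg hθ k)
    ((s_D4_rRec₁₃On_iff _ Rg).mpr fun F θ hP hRg hθ _ _ k => hD4 F θ hP hRg hθ k) h20 h21 hx h19

/-- **… WITH N16's SENTENCE FROM ITS CONTENT FORM** `InEndRegime ∧ LeafSlot` at node00-def-RR-1's layer of every guarded family (dag-n16-e module 19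
`s_N16_rRec₁₃On_ofRecord_of_leafSlot`, pin `rfl` at the reading of record). [bookkeeping] -/
theorem spine_rec13COn_at_readingOfRecord₁₃_of_leafSlot
    (h14 : ∀ (F : T4Family) (θ : Stage13Params F N), θ.Provisos₁₃ F N → Rg F θ → θ.Admissible F N → ∀ (g₀ : ℕ → ℝ) (os : List (ULoop F)),
      N14At (ne1 F θ g₀ os))
    (h15 : ∀ (F : T4Family) (θ : Stage13Params F N), θ.Provisos₁₃ F N → Rg F θ → θ.Admissible F N → ∀ (g₀ : ℕ → ℝ) (os : List (ULoop F)) (k : ℕ),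
      N15At (ne2OfRecord₁₁ (ne2 F θ g₀ os k)))
    (h16 : ∀ (F : T4Family), (∃ θ : Stage13Params F N, θ.Provisos₁₃ F N ∧ Rg F θ ∧ θ.Admissible F N) →
      InEndRegime (ne3OfRecord₁₁ F (ne3ConstLayerOfRecord₁₁ F N (ℓ₃ F))) ∧ LeafSlot (ne3OfRecord₁₁ F (ne3ConstLayerOfRecord₁₁ F N (ℓ₃ F))))
    (h18 : ∀ (F : T4Family) (θ : Stage13Params F N), θ.Provisos₁₃ F N → Rg F θ → θ.Admissible F N → ∀ k : ℕ,
      N18At (u3OfRecord₁₃ θ ((w1 F θ).u3Objects θ.γ) k))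
    (h22 : ∀ (F : T4Family) (θ : Stage13Params F N), θ.Provisos₁₃ F N → Rg F θ → θ.Admissible F N → ∀ k : ℕ,
      N22At (u3OfRecord₁₃ θ ((w1 F θ).u3Objects θ.γ) k))
    (hD4 : ∀ (F : T4Family) (θ : Stage13Params F N) (hP : θ.Provisos₁₃ F N), Rg F θ → θ.Admissible F N → ∀ k : ℕ,
      ReadOutAt (datumOfRecord₁₃ F N θ hP) (u3OfRecord₁₃ θ ((w1 F θ).u3Objects θ.γ) k))
    (h20 : S_N20 (SRec₁₃On cr Rg)) (h21 : S_N21 (SRec₁₃On cr Rg))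
    (hx : ∀ (F : T4Family) (θ : Stage13Params F N) (hP : θ.Provisos₁₃ F N), Rg F θ → θ.Admissible F N →
      B16.EndStatementBPrinted (datumOfRecord₁₃ F N θ hP).C → DagBinding.EndpointExistence (datumOfRecord₁₃ F N θ hP).C.toB12 →
        ForSmallCouplings (datumOfRecord₁₃ F N θ hP) fun g₀ => ∀ os : List (ULoop F),
          0 < (cr F θ hP g₀ os).l₀ ∧ 0 < (cr F θ hP g₀ os).vol ∧
          (∀ (K : ℕ) (t : ℝ), |t| ≤ (cr F θ hP g₀ os).l₀ →
            T4GenFunBounds.schemeZ ((datumOfRecord₁₃ F N θ hP).scheme g₀) os ((cr F θ hP g₀ os).K₀ + K) t =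
              ∑ τ ∈ (cr F θ hP g₀ os).T K, (cr F θ hP g₀ os).A K t τ) ∧
          (∀ (K : ℕ) (t : ℝ), |t| ≤ (cr F θ hP g₀ os).l₀ →
            T4GenFunBounds.schemeZ ((datumOfRecord₁₃ F N θ hP).scheme g₀) os ((cr F θ hP g₀ os).K₀ + K + 1) t =
              ∑ τ ∈ (cr F θ hP g₀ os).T K, (cr F θ hP g₀ os).B K t τ))
    (h19 : ∀ (F : T4Family) (θ : Stage13Params F N) (hP : θ.Provisos₁₃ F N), Rg F θ → θ.Admissible F N → ∀ (g₀ : ℕ → ℝ) (os : List (ULoop F)),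
      (∀ k : ℕ, RatesAt (datumOfRecord₁₃ F N θ hP) (rateCarriersOfRecord₁₃ (readingOfRecord₁₃ w1 ℓ₃ ne2 ne1) F θ hP g₀ os k)) → letI := (cr F θ hP g₀ os).dec
        ∃ δ : ℕ → ℝ, NE7.Core (cr F θ hP g₀ os).l₀ (cr F θ hP g₀ os).vol (cr F θ hP g₀ os).T (cr F θ hP g₀ os).Bad
          (fun K t τ => (cr F θ hP g₀ os).A K t τ - (cr F θ hP g₀ os).shA K t τ) (fun K t τ => (cr F θ hP g₀ os).B K t τ - (cr F θ hP g₀ os).shB K t τ) δ ∧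
          Summable δ) :
    Spine (N := N) fun F D w => Node00.IsRecordOfRecord₁₃COn F N Rg D w :=
  spine_rec13COn_at_readingOfRecord₁₃ cr w1 ℓ₃ ne2 ne1 Rg
    ((s_N14_rRec₁₃On_iff _ Rg).mpr fun F θ hP hRg hθ g₀ os => h14 F θ hP hRg hθ g₀ os)
    ((s_N15_rRec₁₃On_iff _ Rg).mpr fun F θ hP hRg hθ g₀ os k => h15 F θ hP hRg hθ g₀ os k)
    (s_N16_rRec₁₃On_ofRecord_of_leafSlot (readingOfRecord₁₃ w1 ℓ₃ ne2 ne1) Rg ℓ₃ (fun _ _ _ _ _ _ => rfl) h16)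
    ((s_N18_rRec₁₃On_iff _ Rg).mpr fun F θ hP hRg hθ _ _ k => h18 F θ hP hRg hθ k)
    ((s_N22_rRec₁₃On_iff _ Rg).mpr fun F θ hP hRg hθ _ _ k => h22 F θ hP hRg hθ k)
    ((s_D4_rRec₁₃On_iff _ Rg).mpr fun F θ hP hRg hθ _ _ k => hD4 F θ hP hRg hθ k) h20 h21 hx h19

end Regime

/-! ## §3 N22 ELIMINATED GIVEN N18 AT THE READING OF RECORD (dag-n22-e 7″ `…N22EdgeAtW1Reading13` BY NAME: the edge N18 → N22 at the W1-pinned reading, analytic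
sup-letter currency (A) at both homes, STRIP currency at the regime home) — the rate side then displays N14 · N15 · N16 · N18 · (D4) + W1's coherence ∕ regularity inputs -/

section EdgeN22

open Set Metric
open Literature.MathematicalPhysics.QuantumFieldTheory.Balaban1983to89.T4OutputRate (Window)
open Node00 (MatA)
open Node00.Sect2 (domSys CPair)
open Literature.MathematicalPhysics.QuantumFieldTheory.Balaban1983to89.TreeLengthTorus (torusTreeLen)
open Node00.W1 (termC)

/-- **N27 = B5 AT THE STAGE-13 RECORD AT THE CANONICAL HOME OF THE READING OF RECORD, N17 AND N22 ELIMINATED** (§1 `spine_rec13C_at_readingOfRecord₁₃` with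
`h22 := YMDAG.N22.s_N22_readingOfRecord₁₃_of_s_N18_analytic w1 ℓ₃ ne2 ne1 h18 hcoh hA hnum` — dag-n22-e 7″ §4, hypotheses VERBATIM: per admissible Stage-13 tuple with provisos the
pairing coherence ∕ junk clauses (C1)(C2)(J) of `w1 F θ`, the analytic sup-letter (A) of the level functionals on the closed `r`-discs about `]0, θ.γ]`, the letters' numerals): N14 ·
N15 · N16 · N18 · (D4) at `RRec₁₃ (readingOfRecord₁₃ …)`, the K5 stubs at `SRec₁₃ cr` and the home-keyed edge ⇒ `Spine ₁₃C`.  Every hypothesis 0∕1 today. [bookkeeping] -/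
theorem spine_rec13C_at_readingOfRecord₁₃_of_s_N18_analytic
    (h14 : S_N14 (RRec₁₃ (readingOfRecord₁₃ w1 ℓ₃ ne2 ne1))) (h15 : S_N15 (RRec₁₃ (readingOfRecord₁₃ w1 ℓ₃ ne2 ne1)))
    (h16 : S_N16 (RRec₁₃ (readingOfRecord₁₃ w1 ℓ₃ ne2 ne1))) (h18 : S_N18 (RRec₁₃ (readingOfRecord₁₃ w1 ℓ₃ ne2 ne1)))
    (hD4 : S_D4 (RRec₁₃ (readingOfRecord₁₃ w1 ℓ₃ ne2 ne1)))
    (hcoh : ∀ (F : T4Family) (θ : Stage13Params F N), θ.Provisos₁₃ F N → θ.Admissible F N →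
      (∀ (k : ℕ) (X₁ : Node00.W1.Dom (F.P k) θ.τ9.M), (((w1 F θ).pairing k).pair X₁).1 = X₁.1 + 1) ∧
      (∀ (k : ℕ) (X₁ : Node00.W1.Dom (F.P k) θ.τ9.M),
        (domSys (F.P (k + 1)) θ.τ9.M (((w1 F θ).pairing k).pair X₁).1).dj (((w1 F θ).pairing k).pair X₁).2 = (domSys (F.P k) θ.τ9.M X₁.1).dj X₁.2) ∧
      (∀ (k : ℕ) (X : Node00.W1.Dom (F.P (k + 1)) θ.τ9.M), 1 ≤ X.1 → ∃ X₁ : Node00.W1.Dom (F.P k) θ.τ9.M, ((w1 F θ).pairing k).pair X₁ = X) ∧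
      (∀ (k : ℕ) (U : ((w1 F θ).pairing (k + 1)).BgA), ∃ U₁ : ((w1 F θ).pairing k).BgB, ((w1 F θ).pairing k).embB U₁ = ((w1 F θ).pairing (k + 1)).embA U) ∧
      (∀ (k : ℕ) (g : ℕ → ℝ) (U : ((w1 F θ).pairing k).BgA) (X : Node00.W1.Dom (F.P k) θ.τ9.M), k < X.1 → ((w1 F θ).pairing k).EA ((w1 F θ).S k) g U X = 0))
    (hA : ∀ (F : T4Family) (θ : Stage13Params F N), θ.Provisos₁₃ F N → θ.Admissible F N → ∀ (k : ℕ),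
      ∀ g ∈ Window θ.γ, ∀ (U : (((w1 F θ).u3Objects θ.γ).levelCarriers k).BgA) (X : (((w1 F θ).u3Objects θ.γ).levelCarriers k).Dom) (i : ℕ),
        i < (((w1 F θ).u3Objects θ.γ).levelCarriers k).scale X → ∃ (Fz : ℂ → ℂ) (Dset : Set ℂ), DifferentiableOn ℂ Fz Dset ∧
          (∀ z ∈ Dset, ‖Fz z‖ ≤ (w1 F θ).li.A * (w1 F θ).li.μ ^ ((((w1 F θ).u3Objects θ.γ).levelCarriers k).scale X - 1 - i) *
            Real.exp (-(((w1 F θ).u3Objects θ.γ).κ * (((w1 F θ).u3Objects θ.γ).levelCarriers k).d X))) ∧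
          (∀ t ∈ Ioc (0 : ℝ) θ.γ, closedBall (t : ℂ) (w1 F θ).li.r ⊆ Dset) ∧
          (∀ t ∈ Ioc (0 : ℝ) θ.γ, Fz t = (((w1 F θ).u3Objects θ.γ).EA k (Function.update g i t) U X : ℂ)))
    (hnum : ∀ (F : T4Family) (θ : Stage13Params F N), θ.Provisos₁₃ F N → θ.Admissible F N →
      0 < (w1 F θ).li.C₀ ∧ 0 < (w1 F θ).li.θ₅ ∧ (w1 F θ).li.θ₅ < 1 ∧ 0 ≤ (w1 F θ).li.C₅ ∧
        2 * (w1 F θ).li.C₅ / (1 - (w1 F θ).li.θ₅) ≤ (w1 F θ).li.C₀ ∧ 0 < (w1 F θ).li.A ∧ (w1 F θ).li.θ₅ ≤ (w1 F θ).li.μ ∧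
        (w1 F θ).li.C₀ ≤ 2 * (w1 F θ).li.A ∧ 0 < (w1 F θ).li.r ∧ 0 < (w1 F θ).li.s ∧ (w1 F θ).li.s < 1)
    (hx' : S_N27x (fun F D w => IsRecordOfRecord₁₃C F N D w) (SRec₁₃ cr)) (h20 : S_N20 (SRec₁₃ cr)) (h21 : S_N21 (SRec₁₃ cr))
    (h19 : ∀ (F : T4Family) (θ : Stage13Params F N) (hP : θ.Provisos₁₃ F N), θ.Admissible F N → ∀ (g₀ : ℕ → ℝ) (os : List (ULoop F))
      (h : IsDatumOfRecord₁₃C F N (datumOfRecord₁₃ F N θ hP)) (k : ℕ),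
      RatesAt (datumOfRecord₁₃ F N θ hP) (rateCarriersOfRecord₁₃ (readingOfRecord₁₃ w1 ℓ₃ ne2 ne1) F h.params h.provisos g₀ os k) → letI := (cr F θ hP g₀ os).dec
        ∃ δ : ℕ → ℝ, NE7.Core (cr F θ hP g₀ os).l₀ (cr F θ hP g₀ os).vol (cr F θ hP g₀ os).T (cr F θ hP g₀ os).Bad
          (fun K t τ => (cr F θ hP g₀ os).A K t τ - (cr F θ hP g₀ os).shA K t τ) (fun K t τ => (cr F θ hP g₀ os).B K t τ - (cr F θ hP g₀ os).shB K t τ) δ ∧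
          Summable δ) :
    Spine (N := N) fun F D w => IsRecordOfRecord₁₃C F N D w :=
  spine_rec13C_at_readingOfRecord₁₃ cr w1 ℓ₃ ne2 ne1 h14 h15 h16 h18
    (YMDAG.N22.s_N22_readingOfRecord₁₃_of_s_N18_analytic w1 ℓ₃ ne2 ne1 h18 hcoh hA hnum) hD4 hx' h20 h21 h19

variable (Rg : (F : T4Family) → Stage13Params F N → Prop)

/-- **THE REGIME TWIN, ANALYTIC CURRENCY** (§2 `spine_rec13COn_at_readingOfRecord₁₃` with `h22 := YMDAG.N22.s_N22_readingOfRecord₁₃On_of_s_N18_analytic w1 ℓ₃ ne2 ne1 Rg h18 hcoh hA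
hnum`; every input asked ONLY of admissible tuples with provisos IN THE REGIME) ⇒ `Spine (IsRecordOfRecord₁₃COn Rg)`. [bookkeeping] -/
theorem spine_rec13COn_at_readingOfRecord₁₃_of_s_N18_analytic
    (h14 : S_N14 (RRec₁₃On (readingOfRecord₁₃ w1 ℓ₃ ne2 ne1) Rg)) (h15 : S_N15 (RRec₁₃On (readingOfRecord₁₃ w1 ℓ₃ ne2 ne1) Rg))
    (h16 : S_N16 (RRec₁₃On (readingOfRecord₁₃ w1 ℓ₃ ne2 ne1) Rg)) (h18 : S_N18 (RRec₁₃On (readingOfRecord₁₃ w1 ℓ₃ ne2 ne1) Rg))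
    (hD4 : S_D4 (RRec₁₃On (readingOfRecord₁₃ w1 ℓ₃ ne2 ne1) Rg))
    (hcoh : ∀ (F : T4Family) (θ : Stage13Params F N), θ.Provisos₁₃ F N → Rg F θ → θ.Admissible F N →
      (∀ (k : ℕ) (X₁ : Node00.W1.Dom (F.P k) θ.τ9.M), (((w1 F θ).pairing k).pair X₁).1 = X₁.1 + 1) ∧
      (∀ (k : ℕ) (X₁ : Node00.W1.Dom (F.P k) θ.τ9.M),
        (domSys (F.P (k + 1)) θ.τ9.M (((w1 F θ).pairing k).pair X₁).1).dj (((w1 F θ).pairing k).pair X₁).2 = (domSys (F.P k) θ.τ9.M X₁.1).dj X₁.2) ∧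
      (∀ (k : ℕ) (X : Node00.W1.Dom (F.P (k + 1)) θ.τ9.M), 1 ≤ X.1 → ∃ X₁ : Node00.W1.Dom (F.P k) θ.τ9.M, ((w1 F θ).pairing k).pair X₁ = X) ∧
      (∀ (k : ℕ) (U : ((w1 F θ).pairing (k + 1)).BgA), ∃ U₁ : ((w1 F θ).pairing k).BgB, ((w1 F θ).pairing k).embB U₁ = ((w1 F θ).pairing (k + 1)).embA U) ∧
      (∀ (k : ℕ) (g : ℕ → ℝ) (U : ((w1 F θ).pairing k).BgA) (X : Node00.W1.Dom (F.P k) θ.τ9.M), k < X.1 → ((w1 F θ).pairing k).EA ((w1 F θ).S k) g U X = 0))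
    (hA : ∀ (F : T4Family) (θ : Stage13Params F N), θ.Provisos₁₃ F N → Rg F θ → θ.Admissible F N → ∀ (k : ℕ),
      ∀ g ∈ Window θ.γ, ∀ (U : (((w1 F θ).u3Objects θ.γ).levelCarriers k).BgA) (X : (((w1 F θ).u3Objects θ.γ).levelCarriers k).Dom) (i : ℕ),
        i < (((w1 F θ).u3Objects θ.γ).levelCarriers k).scale X → ∃ (Fz : ℂ → ℂ) (Dset : Set ℂ), DifferentiableOn ℂ Fz Dset ∧
          (∀ z ∈ Dset, ‖Fz z‖ ≤ (w1 F θ).li.A * (w1 F θ).li.μ ^ ((((w1 F θ).u3Objects θ.γ).levelCarriers k).scale X - 1 - i) *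
            Real.exp (-(((w1 F θ).u3Objects θ.γ).κ * (((w1 F θ).u3Objects θ.γ).levelCarriers k).d X))) ∧
          (∀ t ∈ Ioc (0 : ℝ) θ.γ, closedBall (t : ℂ) (w1 F θ).li.r ⊆ Dset) ∧
          (∀ t ∈ Ioc (0 : ℝ) θ.γ, Fz t = (((w1 F θ).u3Objects θ.γ).EA k (Function.update g i t) U X : ℂ)))
    (hnum : ∀ (F : T4Family) (θ : Stage13Params F N), θ.Provisos₁₃ F N → Rg F θ → θ.Admissible F N →
      0 < (w1 F θ).li.C₀ ∧ 0 < (w1 F θ).li.θ₅ ∧ (w1 F θ).li.θ₅ < 1 ∧ 0 ≤ (w1 F θ).li.C₅ ∧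
        2 * (w1 F θ).li.C₅ / (1 - (w1 F θ).li.θ₅) ≤ (w1 F θ).li.C₀ ∧ 0 < (w1 F θ).li.A ∧ (w1 F θ).li.θ₅ ≤ (w1 F θ).li.μ ∧
        (w1 F θ).li.C₀ ≤ 2 * (w1 F θ).li.A ∧ 0 < (w1 F θ).li.r ∧ 0 < (w1 F θ).li.s ∧ (w1 F θ).li.s < 1)
    (h20 : S_N20 (SRec₁₃On cr Rg)) (h21 : S_N21 (SRec₁₃On cr Rg))
    (hx : ∀ (F : T4Family) (θ : Stage13Params F N) (hP : θ.Provisos₁₃ F N), Rg F θ → θ.Admissible F N →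
      B16.EndStatementBPrinted (datumOfRecord₁₃ F N θ hP).C → DagBinding.EndpointExistence (datumOfRecord₁₃ F N θ hP).C.toB12 →
        ForSmallCouplings (datumOfRecord₁₃ F N θ hP) fun g₀ => ∀ os : List (ULoop F),
          0 < (cr F θ hP g₀ os).l₀ ∧ 0 < (cr F θ hP g₀ os).vol ∧
          (∀ (K : ℕ) (t : ℝ), |t| ≤ (cr F θ hP g₀ os).l₀ →
            T4GenFunBounds.schemeZ ((datumOfRecord₁₃ F N θ hP).scheme g₀) os ((cr F θ hP g₀ os).K₀ + K) t =
              ∑ τ ∈ (cr F θ hP g₀ os).T K, (cr F θ hP g₀ os).A K t τ) ∧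
          (∀ (K : ℕ) (t : ℝ), |t| ≤ (cr F θ hP g₀ os).l₀ →
            T4GenFunBounds.schemeZ ((datumOfRecord₁₃ F N θ hP).scheme g₀) os ((cr F θ hP g₀ os).K₀ + K + 1) t =
              ∑ τ ∈ (cr F θ hP g₀ os).T K, (cr F θ hP g₀ os).B K t τ))
    (h19 : ∀ (F : T4Family) (θ : Stage13Params F N) (hP : θ.Provisos₁₃ F N), Rg F θ → θ.Admissible F N → ∀ (g₀ : ℕ → ℝ) (os : List (ULoop F)),
      (∀ k : ℕ, RatesAt (datumOfRecord₁₃ F N θ hP) (rateCarriersOfRecord₁₃ (readingOfRecord₁₃ w1 ℓ₃ ne2 ne1) F θ hP g₀ os k)) → letI := (cr F θ hP g₀ os).dec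
        ∃ δ : ℕ → ℝ, NE7.Core (cr F θ hP g₀ os).l₀ (cr F θ hP g₀ os).vol (cr F θ hP g₀ os).T (cr F θ hP g₀ os).Bad
          (fun K t τ => (cr F θ hP g₀ os).A K t τ - (cr F θ hP g₀ os).shA K t τ) (fun K t τ => (cr F θ hP g₀ os).B K t τ - (cr F θ hP g₀ os).shB K t τ) δ ∧
          Summable δ) :
    Spine (N := N) fun F D w => Node00.IsRecordOfRecord₁₃COn F N Rg D w :=
  spine_rec13COn_at_readingOfRecord₁₃ cr w1 ℓ₃ ne2 ne1 Rg h14 h15 h16 h18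
    (YMDAG.N22.s_N22_readingOfRecord₁₃On_of_s_N18_analytic w1 ℓ₃ ne2 ne1 Rg h18 hcoh hA hnum) hD4 h20 h21 hx h19

open Classical in
/-- **THE REGIME TWIN, STRIP CURRENCY** (§2 with `h22 := YMDAG.N22.s_N22_readingOfRecord₁₃On_of_s_N18_stripBound w1 ℓ₃ ne2 ne1 Rg h18 hcoh hnum hstrip` — dag-n22-c's STRIP-(1.18)
tables `sp` per run length with the analytic term extensions on the `r`-discs, numerals incl. `1 ≤ μ`) ⇒ `Spine (IsRecordOfRecord₁₃COn Rg)`. [bookkeeping] -/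
theorem spine_rec13COn_at_readingOfRecord₁₃_of_s_N18_stripBound
    (h14 : S_N14 (RRec₁₃On (readingOfRecord₁₃ w1 ℓ₃ ne2 ne1) Rg)) (h15 : S_N15 (RRec₁₃On (readingOfRecord₁₃ w1 ℓ₃ ne2 ne1) Rg))
    (h16 : S_N16 (RRec₁₃On (readingOfRecord₁₃ w1 ℓ₃ ne2 ne1) Rg)) (h18 : S_N18 (RRec₁₃On (readingOfRecord₁₃ w1 ℓ₃ ne2 ne1) Rg))
    (hD4 : S_D4 (RRec₁₃On (readingOfRecord₁₃ w1 ℓ₃ ne2 ne1) Rg))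
    (hcoh : ∀ (F : T4Family) (θ : Stage13Params F N), θ.Provisos₁₃ F N → Rg F θ → θ.Admissible F N →
      (∀ (k : ℕ) (X₁ : Node00.W1.Dom (F.P k) θ.τ9.M), (((w1 F θ).pairing k).pair X₁).1 = X₁.1 + 1) ∧
      (∀ (k : ℕ) (X₁ : Node00.W1.Dom (F.P k) θ.τ9.M),
        (domSys (F.P (k + 1)) θ.τ9.M (((w1 F θ).pairing k).pair X₁).1).dj (((w1 F θ).pairing k).pair X₁).2 = (domSys (F.P k) θ.τ9.M X₁.1).dj X₁.2) ∧
      (∀ (k : ℕ) (X : Node00.W1.Dom (F.P (k + 1)) θ.τ9.M), 1 ≤ X.1 → ∃ X₁ : Node00.W1.Dom (F.P k) θ.τ9.M, ((w1 F θ).pairing k).pair X₁ = X) ∧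
      (∀ (k : ℕ) (U : ((w1 F θ).pairing (k + 1)).BgA), ∃ U₁ : ((w1 F θ).pairing k).BgB, ((w1 F θ).pairing k).embB U₁ = ((w1 F θ).pairing (k + 1)).embA U) ∧
      (∀ (k : ℕ) (g : ℕ → ℝ) (U : ((w1 F θ).pairing k).BgA) (X : Node00.W1.Dom (F.P k) θ.τ9.M), k < X.1 → ((w1 F θ).pairing k).EA ((w1 F θ).S k) g U X = 0))
    (hnum : ∀ (F : T4Family) (θ : Stage13Params F N), θ.Provisos₁₃ F N → Rg F θ → θ.Admissible F N →
      0 < (w1 F θ).li.C₀ ∧ 0 < (w1 F θ).li.θ₅ ∧ (w1 F θ).li.θ₅ < 1 ∧ 0 ≤ (w1 F θ).li.C₅ ∧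
        2 * (w1 F θ).li.C₅ / (1 - (w1 F θ).li.θ₅) ≤ (w1 F θ).li.C₀ ∧ 0 < (w1 F θ).li.A ∧ (w1 F θ).li.θ₅ ≤ (w1 F θ).li.μ ∧
        (w1 F θ).li.C₀ ≤ 2 * (w1 F θ).li.A ∧ 0 < (w1 F θ).li.r ∧ 0 < (w1 F θ).li.s ∧ (w1 F θ).li.s < 1 ∧ 1 ≤ (w1 F θ).li.μ)
    (hstrip : ∀ (F : T4Family) (θ : Stage13Params F N), θ.Provisos₁₃ F N → Rg F θ → θ.Admissible F N → ∀ (k : ℕ),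
      ∃ sp : (j : ℕ) → (domSys (F.P k) θ.τ9.M j).Dom → Set (CPair (F.P k) (MatA N)),
        (∀ (j : ℕ) (U : ((w1 F θ).pairing k).BgA) (Y : (domSys (F.P k) θ.τ9.M j).Dom), ((w1 F θ).pairing k).embA U ∈ sp j Y) ∧
        (∀ (j : ℕ) (g : ℕ → ℝ), g ∈ Window θ.γ → ∀ (i : ℕ) (Y : (domSys (F.P k) θ.τ9.M j).Dom) (ψ : CPair (F.P k) (MatA N)), ψ ∈ sp j Y →
          ∃ (Ec : ℂ → ℂ) (O : Set ℂ), IsOpen O ∧ (∀ t ∈ Ioc (0 : ℝ) θ.γ, closedBall (t : ℂ) (w1 F θ).li.r ⊆ O) ∧ DifferentiableOn ℂ Ec O ∧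
            (∀ z ∈ O, ‖Ec z‖ ≤ (w1 F θ).li.A * Real.exp (-((w1 F θ).li.κ * torusTreeLen Y.1))) ∧
            (∀ t ∈ Ioc (0 : ℝ) θ.γ, Ec t = termC ((w1 F θ).S k) j Y (Function.update g i t) ψ)))
    (h20 : S_N20 (SRec₁₃On cr Rg)) (h21 : S_N21 (SRec₁₃On cr Rg))
    (hx : ∀ (F : T4Family) (θ : Stage13Params F N) (hP : θ.Provisos₁₃ F N), Rg F θ → θ.Admissible F N →
      B16.EndStatementBPrinted (datumOfRecord₁₃ F N θ hP).C → DagBinding.EndpointExistence (datumOfRecord₁₃ F N θ hP).C.toB12 →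
        ForSmallCouplings (datumOfRecord₁₃ F N θ hP) fun g₀ => ∀ os : List (ULoop F),
          0 < (cr F θ hP g₀ os).l₀ ∧ 0 < (cr F θ hP g₀ os).vol ∧
          (∀ (K : ℕ) (t : ℝ), |t| ≤ (cr F θ hP g₀ os).l₀ →
            T4GenFunBounds.schemeZ ((datumOfRecord₁₃ F N θ hP).scheme g₀) os ((cr F θ hP g₀ os).K₀ + K) t =
              ∑ τ ∈ (cr F θ hP g₀ os).T K, (cr F θ hP g₀ os).A K t τ) ∧
          (∀ (K : ℕ) (t : ℝ), |t| ≤ (cr F θ hP g₀ os).l₀ →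
            T4GenFunBounds.schemeZ ((datumOfRecord₁₃ F N θ hP).scheme g₀) os ((cr F θ hP g₀ os).K₀ + K + 1) t =
              ∑ τ ∈ (cr F θ hP g₀ os).T K, (cr F θ hP g₀ os).B K t τ))
    (h19 : ∀ (F : T4Family) (θ : Stage13Params F N) (hP : θ.Provisos₁₃ F N), Rg F θ → θ.Admissible F N → ∀ (g₀ : ℕ → ℝ) (os : List (ULoop F)),
      (∀ k : ℕ, RatesAt (datumOfRecord₁₃ F N θ hP) (rateCarriersOfRecord₁₃ (readingOfRecord₁₃ w1 ℓ₃ ne2 ne1) F θ hP g₀ os k)) → letI := (cr F θ hP g₀ os).dec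
        ∃ δ : ℕ → ℝ, NE7.Core (cr F θ hP g₀ os).l₀ (cr F θ hP g₀ os).vol (cr F θ hP g₀ os).T (cr F θ hP g₀ os).Bad
          (fun K t τ => (cr F θ hP g₀ os).A K t τ - (cr F θ hP g₀ os).shA K t τ) (fun K t τ => (cr F θ hP g₀ os).B K t τ - (cr F θ hP g₀ os).shB K t τ) δ ∧
          Summable δ) :
    Spine (N := N) fun F D w => Node00.IsRecordOfRecord₁₃COn F N Rg D w :=
  spine_rec13COn_at_readingOfRecord₁₃ cr w1 ℓ₃ ne2 ne1 Rg h14 h15 h16 h18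
    (YMDAG.N22.s_N22_readingOfRecord₁₃On_of_s_N18_stripBound w1 ℓ₃ ne2 ne1 Rg h18 hcoh hnum hstrip) hD4 h20 h21 hx h19

end EdgeN22

end Summit.QuantumFields.YangMills.Theorems.BalabanUVNodesN27SpineRecord
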